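import Literature.MathematicalPhysics.QuantumFieldTheory.Balaban1983to89.T3Thresholds
import HarnessLib

/-!
# Line «sandwich_discharge» on crux `HistoryTailL` (stmt-QuantumFields-19936), stub `stub_sandwichSweepGapCapped` — the first line of its proof:
# UNDER THE SEVERITY CAP THE COARSE THRESHOLD AT THE SWEPT HEIGHT DECAYS GEOMETRICALLY IN THE DEPTH `j`

Cell `ym3-torus` (YM ladder rung R3 = continuum SU(2) Yang–Mills on the three-torus — a RUNG, NOT the Clay problem), width seat `ym3-torus-px8`
gen 6, `--supports` only (helper; ★★OWNER RULING №25 (b): text-independent letter, typed HOME, filed on the LEAD's word).  Skeleton v5 of the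
line (planner ym-r3-idea-2 g13, 2026-08-29) inserted the severity cap `b ≤ 2·(151·L²)^j·b₀` into the sweep-gap stub (LOCATE-SWGAP-px8g6 §3,
19936 evidence #53).  Its point is arithmetic: together with the coupled range `N₁·j + n ≤ K` it forces the level-`j` coarse threshold
`x = θ_{Λb}(K−j)` to be GEOMETRICALLY SMALL in `j`, which (i) excludes the wrap-around critical points of ✓`CovariantDischargeUniformFluxAverages`
and (ii) makes the whole sweep regime perturbative (every loop up to the sweep radius is `≪ 1` by crude Stokes).  THIS FILE proves (the crude,
`γ^{1/4}`-profile form of) that first line, over the tree's uniform threshold bound ✓`T3Thresholds.θBal_le_const_mul_sqrt_coupling`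
(`θ_b₀(i) ≤ b₀(2p₀)^{p₀}e^{½−p₀}·(γL^{−i})^{1/4}`):
★ `θBal_cap_le_pow` — for `L ≥ 1`, `Λ, b₀, p₀ > 0` there is `γ₁ ∈ (0,1]` (`= min 1 (2Λ·b₀(2p₀)^{p₀}e^{½−p₀})⁻⁴`) such that for `0 < γ ≤ γ₁`,
`0 ≤ b ≤ 2(151L²)^j b₀` and `(4M+1)·j ≤ K`:  **`θBal L γ (Λb) p₀ (K − j) ≤ (151·L²·L^{−M})^j`** — so `N₁ := 4M + 1` with `151·L^{2+c} ≤ L^{M}`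
gives `x ≤ L^{−c·j}` (the sharp profile ✓`θBal_le_geometric_sharp` would give `N₁ ≈ 2(2 + c + log_L 151)∕(1−ε)`; not needed here).
WHAT THIS IS NOT: nothing of the capped stub, the crux, the rung R3, d = 4 or a mass gap is proved.  YM₃ on T³ is rung R3, NOT Clay.
References: T. Bałaban, CMP **102** (1985) 255–275 [Balaban1985UV3] ((3) p.256, (7) p.257: `g_k`, `p(g_k)`).  Elementary ([folklore]).
-/

noncomputable section

namespace Summit.QuantumFields.YangMills.Theorems.CovariantDischargeSandwichCapThreshold

open Literature.MathematicalPhysics.QuantumFieldTheory.Balaban1983to89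
open Literature.MathematicalPhysics.QuantumFieldTheory.Balaban1983to89.T3UnitScaleTilt (θBal)
open Literature.MathematicalPhysics.QuantumFieldTheory.Balaban1983to89.T3Thresholds (θBal_eq θBal_le_const_mul_sqrt_coupling)

/-- `√(√(y^{4m})) = y^m` for `y ≥ 0`. [folklore] -/
theorem sqrt_sqrt_pow_four_mul {y : ℝ} (hy : 0 ≤ y) (m : ℕ) : Real.sqrt (Real.sqrt (y ^ (4 * m))) = y ^ m := by
  have h4 : y ^ (4 * m) = (y ^ (2 * m)) ^ 2 := by rw [← pow_mul]; ring_nf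
  have h2 : y ^ (2 * m) = (y ^ m) ^ 2 := by rw [← pow_mul]; ring_nf
  rw [h4, Real.sqrt_sq (pow_nonneg hy _), h2, Real.sqrt_sq (pow_nonneg hy _)]

/-- Bałaban's threshold is LINEAR in the profile constant (tree `B10.pFun b p₀ g = b(1 + log g⁻¹)^{p₀}`): `θ_{Λb}(i) = (Λb∕b₀)·θ_{b₀}(i)`.
[cite: Balaban1985UV3, (7) p.257] -/
theorem θBal_eq_div_mul {L : ℕ} {γ b₀ p₀ : ℝ} (hb₀ : b₀ ≠ 0) (Λ b : ℝ) (i : ℕ) :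
    θBal L γ (Λ * b) p₀ i = (Λ * b / b₀) * θBal L γ b₀ p₀ i := by
  rw [θBal_eq, θBal_eq]
  unfold B10.pFun
  field_simp

/-- ★ **UNDER THE SEVERITY CAP THE SWEPT-HEIGHT THRESHOLD DECAYS GEOMETRICALLY IN THE DEPTH**: for `L ≥ 1`, `Λ, b₀, p₀ > 0` there is
`γ₁ ∈ (0,1]` such that for `0 < γ ≤ γ₁`, every base `0 ≤ b ≤ 2·(151·L²)^j·b₀` and every coupled pair `(4M+1)·j ≤ K`,
`θ_{Λb}(K − j) ≤ (151·L²·L^{−M})^j`.  (Severity cap × coupled range ⇒ the «small regime» of the capped sweep stub is as small as its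
`N₁` wants; the critical-point corner of the uncapped text needs `θ_{Λb}(K−j) ≥ x_lo(Λ,L) > 0`.) [cite: Balaban1985UV3, (7) p.257] -/
theorem θBal_cap_le_pow {L : ℕ} (hL : 1 ≤ L) {Λ b₀ p₀ : ℝ} (hΛ : 0 < Λ) (hb₀ : 0 < b₀) (hp₀ : 0 < p₀) :
    ∃ γ₁ : ℝ, 0 < γ₁ ∧ γ₁ ≤ 1 ∧ ∀ γ : ℝ, 0 < γ → γ ≤ γ₁ → ∀ (b : ℝ) (K j M : ℕ), 0 ≤ b →
      b ≤ 2 * (151 * (L : ℝ) ^ 2) ^ j * b₀ → (4 * M + 1) * j ≤ K →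
        θBal L γ (Λ * b) p₀ (K - j) ≤ (151 * (L : ℝ) ^ 2 * ((L : ℝ)⁻¹) ^ M) ^ j := by
  set C : ℝ := b₀ * ((2 * p₀) ^ p₀ * Real.exp (1 / 2 - p₀)) with hC_def
  have hC : 0 < C := by positivity
  set δ : ℝ := (2 * Λ * C)⁻¹ with hδ_def
  have hδ : 0 < δ := by positivity
  refine ⟨min 1 ((δ ^ 2) ^ 2), lt_min one_pos (by positivity), min_le_left _ _, ?_⟩
  intro γ hγ hγ1 b K j M hb hcap hK
  have hγone : γ ≤ 1 := hγ1.trans (min_le_left _ _)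
  have hγδ : γ ≤ (δ ^ 2) ^ 2 := hγ1.trans (min_le_right _ _)
  have hL0 : (0 : ℝ) ≤ ((L : ℝ)⁻¹) := inv_nonneg.mpr (Nat.cast_nonneg _)
  have hL1 : ((L : ℝ)⁻¹) ≤ 1 := inv_le_one_of_one_le₀ (by exact_mod_cast hL)
  -- `√√γ ≤ δ`
  have hsqγ : Real.sqrt (Real.sqrt γ) ≤ δ := by
    calc Real.sqrt (Real.sqrt γ) ≤ Real.sqrt (Real.sqrt ((δ ^ 2) ^ 2)) := Real.sqrt_le_sqrt (Real.sqrt_le_sqrt hγδ)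
      _ = δ := by rw [Real.sqrt_sq (sq_nonneg _), Real.sqrt_sq hδ.le]
  -- the depth `i = K − j ≥ 4Mj`, so `√√((L⁻¹)^i) ≤ (L⁻¹)^{Mj}`
  have hi : 4 * (M * j) ≤ K - j := by
    have : (4 * M + 1) * j = 4 * (M * j) + j := by ring
    omega
  have hpow : ((L : ℝ)⁻¹) ^ (K - j) ≤ ((L : ℝ)⁻¹) ^ (4 * (M * j)) := pow_le_pow_of_le_one hL0 hL1 hi
  have hsqL : Real.sqrt (Real.sqrt (((L : ℝ)⁻¹) ^ (K - j))) ≤ (((L : ℝ)⁻¹) ^ M) ^ j := by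
    calc Real.sqrt (Real.sqrt (((L : ℝ)⁻¹) ^ (K - j))) ≤ Real.sqrt (Real.sqrt (((L : ℝ)⁻¹) ^ (4 * (M * j)))) :=
          Real.sqrt_le_sqrt (Real.sqrt_le_sqrt hpow)
      _ = (((L : ℝ)⁻¹) ^ M) ^ j := by rw [sqrt_sqrt_pow_four_mul hL0, pow_mul]
  -- the base threshold
  have hθ₀ : θBal L γ b₀ p₀ (K - j) ≤ C * (δ * (((L : ℝ)⁻¹) ^ M) ^ j) := by
    refine (θBal_le_const_mul_sqrt_coupling hL hγ hγone hb₀.le hp₀ (K - j)).trans ?_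
    rw [← hC_def, Real.sqrt_mul' _ (pow_nonneg hL0 _), Real.sqrt_mul' _ (Real.sqrt_nonneg _)]
    exact mul_le_mul_of_nonneg_left (mul_le_mul hsqγ hsqL (Real.sqrt_nonneg _) hδ.le) hC.le
  have hθ₀' : 0 ≤ θBal L γ b₀ p₀ (K - j) := by
    rw [θBal_eq]
    exact mul_nonneg (Real.sqrt_nonneg _) (B10.pFun_nonneg b₀ p₀ _ hb₀.le
      (T3ThresholdSmallness.sqrt_coupling_pos_le hL hγ (K - j)).1 (T3Thresholds.coupling_le_one hL hγ hγone (K - j)))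
  -- assemble
  rw [θBal_eq_div_mul hb₀.ne' Λ b (K - j)]
  have hratio : Λ * b / b₀ ≤ 2 * Λ * (151 * (L : ℝ) ^ 2) ^ j := by
    rw [div_le_iff₀ hb₀]
    nlinarith [hcap, hΛ.le]
  have hratio0 : 0 ≤ Λ * b / b₀ := by positivity
  calc Λ * b / b₀ * θBal L γ b₀ p₀ (K - j)
      ≤ (2 * Λ * (151 * (L : ℝ) ^ 2) ^ j) * (C * (δ * (((L : ℝ)⁻¹) ^ M) ^ j)) :=
        mul_le_mul hratio hθ₀ hθ₀' (by positivity)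
    _ = (2 * Λ * C * δ) * ((151 * (L : ℝ) ^ 2) ^ j * (((L : ℝ)⁻¹) ^ M) ^ j) := by ring
    _ = (151 * (L : ℝ) ^ 2 * ((L : ℝ)⁻¹) ^ M) ^ j := by
        rw [hδ_def, mul_inv_cancel₀ (by positivity : (2 * Λ * C) ≠ 0), one_mul, ← mul_pow]

end Summit.QuantumFields.YangMills.Theorems.CovariantDischargeSandwichCapThreshold

end
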